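import Summits.QuantumFields.YangMills.Theorems.LangevinControlUVOSLegsAtWeakCouplingCStubLocalityBumps
import Summits.QuantumFields.YangMills.Theorems.LangevinControlUVOSLegsAtWeakCouplingCStubLocalityNullClosure
import Summits.QuantumFields.YangMills.Theorems.LangevinControlUVOSLegsAtWeakCouplingCStubLocalityRegularise
import Summits.QuantumFields.YangMills.Theorems.LangevinControlUVOSLegsAtWeakCouplingCStubLocalityFlatApprox
import Mathlib.MeasureTheory.Measure.Haar.InnerProductSpace
import HarnessLib

/-!
# Reduction of isometry invariance on `⁰𝒮` to local invariance on product bumps (helper of `stub_locality`)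

Helper file for stub `stub_locality` of crux `OSLegsAtWeakCouplingC` (stmt-QuantumFields-16207, line `Sketch`):
`theorem invariant_of_local_bumpInvariance`, the SOFT REDUCTION of the locality argument.  Let `S₁` be a one-field
family with bounded densities off the diagonal (`OffDiagDensity S₁`) and `R` a linear isometry of `ℝ⁴`.  Suppose that
for every `n ≥ 2`, outside a closed Lebesgue-null set `N` of configurations, every configuration `c` has a
neighbourhood `V` and a width `ε₀ > 0` such that `S₁ n` takes the same value on the product bumps
`⊗ᵢ ρ(· − c'ᵢ)` and `⊗ᵢ ρ(· − R c'ᵢ)` for all `c' ∈ V` and all radial real profiles `ρ` supported in a closed ball of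
radius `< ε₀` (the analytic core of the lead's proof).  Then `S₁ n (linActMulti R F) = S₁ n F` for every `n ≥ 2` and
every off-diagonal `F`.

Proof.  Fix `n ≥ 2` and the defect functional `D := S₁ n ∘ linActMulti R − S₁ n`, a continuous linear functional.

* `D` has bounded densities off the diagonal: `linActMulti R F = F ∘ (R⁻¹)^{×n}` is compactly supported and separated
  when `F` is (isometries preserve pairwise distances) and has the same `L¹` norm (`(R⁻¹)^{×n}` preserves Lebesgue
  measure: `LinearIsometryEquiv.measurePreserving`, `MeasureTheory.volume_preserving_pi`).
* `D` vanishes locally outside `N`: shrink `V` to its interior, take the radial approximate identity `ρ_δ` of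
  `exists_radial_approxIdentity_eq_zero`; by `linActMulti_prodBumps` and the hypothesis `D` kills every product bump
  `⊗ᵢ ρ_δ(· − yᵢ)` with `y ∈ interior V`, `δ < ε₀`, hence (regularisation) every compactly supported `F` with
  `tsupport F ⊆ interior V`.
* `eq_zero_of_null_exceptional` (null-set closure) gives `D u = 0` for every compactly supported `u` supported in
  `Separated n δ`, `δ > 0`; such `u` approximate every off-diagonal `F` in `𝓢`
  (`exists_separated_tendsto_of_isOffDiagonal`), and `D` is continuous.

Refs: OsterwalderSchrader1975 Ch. VI.1; Hörmander, *ALPDO I*, Thm 2.2.1, Thm 4.1.4; GlimmJaffe1987 §6.1.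
-/

set_option autoImplicit false

noncomputable section

open scoped SchwartzMap
open MeasureTheory Filter Topology
open Literature.MathematicalPhysics.QuantumFieldTheory Literature.MathematicalPhysics.QuantumLattice
open Literature.MathematicalPhysics.AQFT
open Summit.QuantumFields.YangMills.Cruxes.OSLegsAtWeakCouplingC.Sketch

namespace Summit.QuantumFields.YangMills.Theorems.OSLegsAtWeakCouplingC

/-! ### `linActMulti` and compactly supported separated test functions -/

variable {n : ℕ}

/-- Pointwise, `linActMulti R F` is `F` composed with the coordinatewise inverse isometry. -/
theorem coe_linActMulti_eq_comp (R : EuclideanSpace ℝ (Fin 4) ≃ₗᵢ[ℝ] EuclideanSpace ℝ (Fin 4))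
    (F : 𝓢((Fin n → EuclideanSpace ℝ (Fin 4)), ℂ)) :
    (linActMulti R F : (Fin n → EuclideanSpace ℝ (Fin 4)) → ℂ) =
      (F : (Fin n → EuclideanSpace ℝ (Fin 4)) → ℂ) ∘
        fun (x : Fin n → EuclideanSpace ℝ (Fin 4)) (i : Fin n) => R.symm (x i) :=
  rfl

/-- The coordinatewise action `x ↦ (R⁻¹ xᵢ)ᵢ` of a linear isometry preserves Lebesgue measure on `(ℝ⁴)ⁿ`
(`LinearIsometryEquiv.measurePreserving` in each factor, `MeasureTheory.volume_preserving_pi`). -/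
theorem measurePreserving_piCoord_symm (R : EuclideanSpace ℝ (Fin 4) ≃ₗᵢ[ℝ] EuclideanSpace ℝ (Fin 4)) :
    MeasurePreserving (fun (x : Fin n → EuclideanSpace ℝ (Fin 4)) (i : Fin n) => R.symm (x i)) :=
  volume_preserving_pi fun _ => R.symm.measurePreserving

/-- The coordinatewise action of the inverse isometry is (the map of) a homeomorphism of `(ℝ⁴)ⁿ`. -/
theorem coe_piCongrRight_symm_toHomeomorph (R : EuclideanSpace ℝ (Fin 4) ≃ₗᵢ[ℝ] EuclideanSpace ℝ (Fin 4)) :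
    ⇑((ContinuousLinearEquiv.piCongrRight fun _ : Fin n => R.symm.toContinuousLinearEquiv).toHomeomorph) =
      fun (x : Fin n → EuclideanSpace ℝ (Fin 4)) (i : Fin n) => R.symm (x i) :=
  rfl

/-- `linActMulti R F` has the same `L¹` norm as `F` (change of variables by a measure-preserving
homeomorphism). -/
theorem integral_norm_linActMulti (R : EuclideanSpace ℝ (Fin 4) ≃ₗᵢ[ℝ] EuclideanSpace ℝ (Fin 4))
    (F : 𝓢((Fin n → EuclideanSpace ℝ (Fin 4)), ℂ)) :
    ∫ x, ‖linActMulti R F x‖ = ∫ x, ‖F x‖ := by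
  have hΦ : MeasurableEmbedding (fun (x : Fin n → EuclideanSpace ℝ (Fin 4)) (i : Fin n) => R.symm (x i)) := by
    rw [← coe_piCongrRight_symm_toHomeomorph R]
    exact Homeomorph.measurableEmbedding _
  simp only [linActMulti_apply]
  exact (measurePreserving_piCoord_symm R).integral_comp hΦ (fun y => ‖F y‖)

/-- `linActMulti R F` is compactly supported if `F` is. -/
theorem linActMulti_hasCompactSupport (R : EuclideanSpace ℝ (Fin 4) ≃ₗᵢ[ℝ] EuclideanSpace ℝ (Fin 4))
    {F : 𝓢((Fin n → EuclideanSpace ℝ (Fin 4)), ℂ)}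
    (hF : HasCompactSupport (F : (Fin n → EuclideanSpace ℝ (Fin 4)) → ℂ)) :
    HasCompactSupport (linActMulti R F : (Fin n → EuclideanSpace ℝ (Fin 4)) → ℂ) := by
  rw [coe_linActMulti_eq_comp, ← coe_piCongrRight_symm_toHomeomorph R]
  exact hF.comp_homeomorph _

/-- `linActMulti R` preserves the class of test functions supported at pairwise distances `≥ δ` (an isometry
preserves pairwise distances). -/
theorem tsupport_linActMulti_subset_separated (R : EuclideanSpace ℝ (Fin 4) ≃ₗᵢ[ℝ] EuclideanSpace ℝ (Fin 4))
    {F : 𝓢((Fin n → EuclideanSpace ℝ (Fin 4)), ℂ)} {δ : ℝ}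
    (hF : tsupport (F : (Fin n → EuclideanSpace ℝ (Fin 4)) → ℂ) ⊆ Separated n δ) :
    tsupport (linActMulti R F : (Fin n → EuclideanSpace ℝ (Fin 4)) → ℂ) ⊆ Separated n δ := by
  intro x hx
  have hcont : Continuous (fun (x : Fin n → EuclideanSpace ℝ (Fin 4)) (i : Fin n) => R.symm (x i)) :=
    continuous_pi fun i => R.symm.continuous.comp (continuous_apply i)
  rw [coe_linActMulti_eq_comp] at hx
  have hx' := hF (tsupport_comp_subset_preimage (F : (Fin n → EuclideanSpace ℝ (Fin 4)) → ℂ) hcont hx)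
  intro i j hij
  have h := hx' i j hij
  rwa [LinearIsometryEquiv.dist_map] at h

/-! ### The registered helper -/

/-- **Reduction of isometry invariance on `⁰𝒮` to local invariance on product bumps** (helper of `stub_locality`).
If a one-field family `S₁` has bounded densities off the diagonal and, for every `n ≥ 2`, outside a closed null set
of configurations every configuration has a neighbourhood on which `S₁ n` takes the same value on the product bumps
centred at `c'` and at `R ∘ c'` for all narrow radial real profiles, then the linear isometry `R` fixes `S₁ n` on every
off-diagonal test function, `n ≥ 2`.  Proof: the defect functional `D = S₁ n ∘ linActMulti R − S₁ n` has bounded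
densities off the diagonal (isometries preserve `L¹` norms and separation) and vanishes locally outside the null set
(regularisation by the radial approximate identity, `exists_radial_approxIdentity_eq_zero`); the null-set closure
`eq_zero_of_null_exceptional` kills `D` on compactly supported separated test functions, which are dense in `⁰𝒮`
(`exists_separated_tendsto_of_isOffDiagonal`). -/
theorem invariant_of_local_bumpInvariance : ∀ (S₁ : SchwingerFamily (EuclideanSpace ℝ (Fin 4))), OffDiagDensity S₁ → ∀ (R : EuclideanSpace ℝ (Fin 4) ≃ₗᵢ[ℝ] EuclideanSpace ℝ (Fin 4)), (∀ n : ℕ, 2 ≤ n → ∃ N : Set (Fin n → EuclideanSpace ℝ (Fin 4)), IsClosed N ∧ MeasureTheory.volume N = 0 ∧ ∀ c : Fin n → EuclideanSpace ℝ (Fin 4), c ∉ N → ∃ V ∈ nhds c, ∃ ε₀ : ℝ, 0 < ε₀ ∧ ∀ (ρ : 𝓢(EuclideanSpace ℝ (Fin 4), ℂ)) (r : ℝ), tsupport (ρ : EuclideanSpace ℝ (Fin 4) → ℂ) ⊆ Metric.closedBall 0 r → 0 ≤ r → r < ε₀ → (∀ (P : EuclideanSpace ℝ (Fin 4) ≃ₗᵢ[ℝ]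 EuclideanSpace ℝ (Fin 4)) (x : EuclideanSpace ℝ (Fin 4)), ρ (P x) = ρ x) → (∀ x, (starRingEnd ℂ) (ρ x) = ρ x) → ∀ c' ∈ V, S₁ n (prodBumps ρ n (fun i => R (c' i))) = S₁ n (prodBumps ρ n c')) → ∀ (n : ℕ), 2 ≤ n → ∀ F : 𝓢((Fin n → EuclideanSpace ℝ (Fin 4)), ℂ), IsOffDiagonal F → S₁ n (linActMulti R F) = S₁ n F := by
  intro S₁ hD R hloc n hn F hF
  -- the defect functional
  set D : 𝓢((Fin n → EuclideanSpace ℝ (Fin 4)), ℂ) →L[ℂ] ℂ := (S₁ n).comp (linActMulti R) - S₁ n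
  have hD_apply : ∀ G : 𝓢((Fin n → EuclideanSpace ℝ (Fin 4)), ℂ), D G = S₁ n (linActMulti R G) - S₁ n G :=
    fun G => rfl
  -- Step 1: `D` vanishes on compactly supported test functions supported off the diagonal
  have hsep : ∀ δ : ℝ, 0 < δ → ∀ u : 𝓢((Fin n → EuclideanSpace ℝ (Fin 4)), ℂ),
      HasCompactSupport (u : (Fin n → EuclideanSpace ℝ (Fin 4)) → ℂ) →
      tsupport (u : (Fin n → EuclideanSpace ℝ (Fin 4)) → ℂ) ⊆ Separated n δ → D u = 0 := by
    obtain ⟨N, hN, hN0, hV⟩ := hloc n hn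
    obtain ⟨ρf, hρf, hreg⟩ := exists_radial_approxIdentity_eq_zero
    intro δ hδ u huc huδ
    refine eq_zero_of_null_exceptional D N hN hN0 ?_ ?_ δ hδ u huc huδ
    · -- bounded densities of the defect functional
      intro δ' hδ'
      obtain ⟨B, hB⟩ := hD n δ' hδ'
      refine ⟨B + B, fun G hGc hGδ => ?_⟩
      rw [hD_apply]
      calc ‖S₁ n (linActMulti R G) - S₁ n G‖ ≤ ‖S₁ n (linActMulti R G)‖ + ‖S₁ n G‖ := norm_sub_le _ _
        _ ≤ (B * ∫ x, ‖linActMulti R G x‖) + B * ∫ x, ‖G x‖ :=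
          add_le_add (hB _ (linActMulti_hasCompactSupport R hGc) (tsupport_linActMulti_subset_separated R hGδ))
            (hB G hGc hGδ)
        _ = (B + B) * ∫ x, ‖G x‖ := by rw [integral_norm_linActMulti, add_mul]
    · -- local vanishing outside the null set, by regularisation
      intro c hc
      obtain ⟨V, hVc, ε₀, hε₀, hinv⟩ := hV c hc
      refine ⟨interior V, interior_mem_nhds.mpr hVc, fun G hGc hGV => ?_⟩
      refine hreg n D (interior V) isOpen_interior ε₀ hε₀ (fun δ' hδ' hδ'ε y hy => ?_) G hGc hGV
      obtain ⟨hsuppρ, hradρ, hrealρ⟩ := hρf δ' hδ'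
      have hP : ∀ x, ρf δ' (R.symm x) = ρf δ' x := fun x => hradρ R.symm x
      show D (prodBumps (ρf δ') n y) = 0
      rw [hD_apply, linActMulti_prodBumps (ρf δ') R hP y, sub_eq_zero]
      exact hinv (ρf δ') δ' hsuppρ hδ'.le hδ'ε hradρ hrealρ y (interior_subset hy)
  -- Step 2: compactly supported separated test functions are dense in `⁰𝒮`, and `D` is continuous
  obtain ⟨u, huc, husep, hu⟩ := exists_separated_tendsto_of_isOffDiagonal F hF
  have hDu : ∀ m, D (u m) = 0 := fun m => by
    obtain ⟨δ, hδ, hδu⟩ := husep m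
    exact hsep δ hδ (u m) (huc m) hδu
  have h1 : Tendsto (fun m => D (u m)) atTop (𝓝 (D F)) := (D.continuous.tendsto F).comp hu
  have h2 : (fun m => D (u m)) = fun _ => (0 : ℂ) := funext hDu
  rw [h2] at h1
  have hDF : D F = 0 := tendsto_nhds_unique h1 tendsto_const_nhds
  rw [hD_apply, sub_eq_zero] at hDF
  exact hDF

end Summit.QuantumFields.YangMills.Theorems.OSLegsAtWeakCouplingC

end
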